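import Summits.QuantumFields.BalabanUV.T4Continuum.Support.NE7OneStepOfPathOpen
import HarnessLib

/-!
# NE7DataPathExp — PATH DISCHARGED ON THE EXPONENTIAL CHART AROUND A FLAT DATUM: for data `V = W·e^{A}` (`W` a flat datum with flat admissible lifts,
# `A` skew, `N`-periodic, sup-small) the path `τ ↦ W·e^{τA}` is continuous, stays in the small data, starts at `W` and ends at `V` — so for such data
# ONE-STEP ⇐ OPEN ∧ REP_w (F20 with PATH supplied)

Cell `pub-balaban`, rung (B)+1 sub-cell t4, lineage `b2b-balaban-t4-ne7-p1`, generation 67 (CRUX PROVER NE7 #1); hunt (h11), memo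
`t4/b2b-balaban-t4-ne7-p1-g67/HUNT-H11-NORMAL-CURRENCY.md` §3 (PATH).  File F21 (over F20 `NE7OneStepOfPathOpen`, F17 `NE7PushForwardContinuity` §1).

WHAT ([folklore]; 0 def, 0 sorry).
§1 `continuous_expPath` (`τ ↦ vary W (τ•A) 1` is continuous into the product topology — F17's `continuousOn_vary_param`), `expPath_zero` (`= W`), `expPath_one`
   (`= vary W A 1`), `expPath_mem_sfClass₀` (for `W` unitary `N`-periodic with `SmallField W δ₀`, `A` skew `N`-periodic with `‖A‖ ≤ β`, `τ ∈ [0,1]`: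
   `vary W (τ•A) 1 ∈ sfClass d L N (δ₀ + 4(e^β − 1)) 0` — row NE3's `smallField_vary`, `vary_isUnitaryCfg`, `vary_add_period`).
§2 **`oneStep_of_expChart_open_repW`** (generic `d`, `L ≥ 2`; the `d = 4`, `L = 2` cases follow the same way from F20's `oneStep_SU2∕SU3_of_path_open_repW`): for a datum `V = vary W A 1` in the
   exponential chart around a datum `W` that carries flat admissible lifts at every level (`∀ k, ∃ U₀ ∈ admissible (sfClass d L N ε) L (k+1) W, SmallField U₀ 0`
   — `W = flatCfg` qualifies by `flatCfg_mem_admissible`), ONE-STEP (the `hstep` binder) follows from (OPEN) along the path and REP_w at `V` ALONE.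
WHICH DATA THIS COVERS (honest): exactly the sup-exponential chart `{W·e^{A}}` around flat data `W` with flat lifts; that every `V ∈ sfClass d L N δ_V 0`
(small plaquettes on the `N`-torus) lies in such a chart for small `δ_V` is NOT proved here — in axial gauge the contractible bonds give `‖A‖ ≤ O(N·δ_V)`, but
the Polyakov holonomies must first be moved to an exactly commuting (flat) tuple: the almost-commuting-unitaries point of memo H11 §3, OPEN.
HONEST FRAMING (page 1).  PATH for the chart is kinematics; (OPEN) and REP_w remain HYPOTHESES carrying all the analysis; NOT ONE-STEP, NOT NE7; spine 0∕9;
finite T⁴ rung (B)+1 — NOT infinite volume, NOT mass gap, NOT Clay.  Continuum YM on T⁴ ⇐ BetaPertH ∧ nine spine estimates (0/9 proved); BetaPertH ⇐ (D1) ∧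
(D4) ∧ CAP+tail; G-an2-4 gates asym, D1 and NE2/3/4.
-/

set_option autoImplicit false

open scoped BigOperators Matrix Matrix.Norms.L2Operator Topology
open NormedSpace Finset Set Filter

namespace Summit.QuantumFields.BalabanUV.T4Continuum.NE7DataPathExp

open Literature.MathematicalPhysics.QuantumFieldTheory.Balaban1983to89
open B7Prop1Explicit B7Prop2Explicit MatrixLog UnitaryModel
open T4AveragingDeficitWall (IsUnitaryCfg IsSkewDir SmallField vary curl curlSq dirSq)
open T4AveragingDeficitWallBoundary (IsPeriodicCfg periodBox)
open AveragingDeficitPeriodicCounting (IsPeriodicDir)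
open AveragingDeficitPlaqDeriv (vary_isUnitaryCfg)
open AveragingDeficitMultiLevelPrep (tower LevelSmall TangentIter)
open MinimalActionLevels (levelAction perWin)
open MinimalActionSandwich (IsMinimiser admissible)
open MinimalActionRate (sfClass)
open NE3HessForm (dAction)
open NE3SlicePoincareShape (SlicePoincare)
open NE3FrameFreeSliceW (frameFreeBlockLandauW)
open NE3EnergyWeightedShapes (energyNormW)
open NE3SlicePoincareBudgetLine (CPLine)
open NE3EnergyVary (smallField_vary)
open NE7PushForwardContinuity (continuousOn_vary_param isSkewDir_smul)
open NE7OneStepOfPathOpen (oneStep_of_path_open_repW oneStep_SU2_of_path_open_repW oneStep_SU3_of_path_open_repW)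

noncomputable section

variable {d : ℕ} {n : Type*} [Fintype n] [DecidableEq n]

/-! ## §1 The exponential path `τ ↦ W·e^{τA}` -/

/-- The exponential path is continuous into the product topology. [folklore] -/
theorem continuous_expPath (W : Site d → Fin d → (Matrix n n ℂ)ˣ) (A : Site d → Fin d → Matrix n n ℂ) :
    Continuous fun τ : ℝ => vary W (τ • A) 1 := by
  rw [← continuousOn_univ]
  have hψ : ∀ (x : Site d) (μ : Fin d), ContinuousOn (fun τ : ℝ => (τ • A) x μ) univ := fun x μ => by
    have h : Continuous fun τ : ℝ => τ • A x μ := continuous_id.smul continuous_const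
    simpa only [Pi.smul_apply] using h.continuousOn
  have h := continuousOn_vary_param (P := ℝ) (S := univ) (V := fun _ => W) (ψ := fun τ : ℝ => τ • A) continuousOn_const hψ 1
  exact h.congr fun τ _ => by simp only [one_smul]

/-- The exponential path starts at `W`. [folklore] -/
theorem expPath_zero (W : Site d → Fin d → (Matrix n n ℂ)ˣ) (A : Site d → Fin d → Matrix n n ℂ) : vary W ((0 : ℝ) • A) 1 = W := by
  funext x μ
  refine Units.ext ?_
  simp only [vary, zero_smul, Pi.zero_apply, smul_zero, Units.val_mul, val_expUnit, NormedSpace.exp_zero, mul_one]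

/-- The exponential path ends at `W·e^{A}`. [folklore] -/
theorem expPath_one (W : Site d → Fin d → (Matrix n n ℂ)ˣ) (A : Site d → Fin d → Matrix n n ℂ) : vary W ((1 : ℝ) • A) 1 = vary W A 1 := by
  rw [one_smul]

/-- **THE EXPONENTIAL PATH STAYS IN THE SMALL DATA**: `W` unitary, `N`-periodic, `SmallField W δ₀`; `A` skew, `N`-periodic, `‖A‖ ≤ β` ⟹ for `τ ∈ [0,1]`,
`W·e^{τA} ∈ sfClass d L N (δ₀ + 4(e^β − 1)) 0`. [folklore] -/
theorem expPath_mem_sfClass₀ [Nonempty n] (L N : ℕ) {W : Site d → Fin d → (Matrix n n ℂ)ˣ} (hWu : IsUnitaryCfg W) (hWP : IsPeriodicCfg W (N : ℤ))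
    {δ₀ : ℝ} (hWδ : SmallField W δ₀) {A : Site d → Fin d → Matrix n n ℂ} (hAs : IsSkewDir A) (hAP : IsPeriodicDir A (N : ℤ)) {β : ℝ}
    (hAβ : ∀ (x : Site d) (μ : Fin d), ‖A x μ‖ ≤ β) {τ : ℝ} (hτ : τ ∈ Icc (0 : ℝ) 1) :
    vary W (τ • A) 1 ∈ sfClass d L N (δ₀ + 4 * (Real.exp β - 1)) 0 := by
  have hτA : ∀ (x : Site d) (μ : Fin d), ‖(τ • A) x μ‖ ≤ β := by
    intro x μ
    rw [Pi.smul_apply, Pi.smul_apply, norm_smul, Real.norm_eq_abs, abs_of_nonneg hτ.1]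
    calc τ * ‖A x μ‖ ≤ 1 * ‖A x μ‖ := mul_le_mul_of_nonneg_right hτ.2 (norm_nonneg _)
      _ ≤ β := by rw [one_mul]; exact hAβ x μ
  refine ⟨vary_isUnitaryCfg hWu (isSkewDir_smul τ hAs) 1, ?_, ?_⟩
  · have hP : IsPeriodicCfg (vary W (τ • A) 1) (N : ℤ) :=
      NE3QuadRemainderTower.vary_add_period hWP (fun y i κ => by simp only [Pi.smul_apply, hAP y i κ]) 1
    simpa using hP
  · simpa using smallField_vary hWu hWδ (isSkewDir_smul τ hAs) hτA

/-! ## §2 ONE-STEP on the exponential chart around a flat datum from OPEN ∧ REP_w -/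

/-- **ONE-STEP ⇐ OPEN ∧ REP_w FOR DATA IN THE EXPONENTIAL CHART AROUND A DATUM WITH FLAT LIFTS** (generic `d`, `L ≥ 2`): `V = vary W A 1`, `W` carrying at every
level an admissible configuration with all plaquette variables `1` (`W = flatCfg` qualifies), the path `τ ↦ vary W (τ•A) 1` (continuous, §1; whether it stays in the
data class is `expPath_mem_sfClass₀` and is the user's concern through (OPEN)); (OPEN) along that path and REP_w at `V` are the hypotheses; (P♮)_W, the level family
and the class smallness as in F20. [folklore] -/
theorem oneStep_of_expChart_open_repW [Nonempty n] {L N : ℕ} [NeZero L] [NeZero N] (hL : 2 ≤ L) (hN : 1 ≤ N) {ε δ CP : ℝ} (hε0 : 0 ≤ ε)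
    (hε1 : 16 * C0 d * ε ≤ 3) (hε2 : 1024 * (d + 1) * (d + 4) * (L : ℝ) ^ 2 * ε ≤ 1) (hδ : 0 ≤ δ) (hCP : 0 < CP)
    (hls : ∀ k : ℕ, LevelSmall d L k (ε / ((L : ℝ) ^ (k + 1)) ^ 2))
    (hP : ∀ (j : ℕ) (W' : Site d → Fin d → (Matrix n n ℂ)ˣ), W' ∈ sfClass d L N ε (j + 1) →
      SlicePoincare L (j + 1) W' (frameFreeBlockLandauW L N (j + 1) W') CP (periodBox (d := d) (N * L ^ (j + 1))))
    (W : Site d → Fin d → (Matrix n n ℂ)ˣ) (A : Site d → Fin d → Matrix n n ℂ)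
    (h0 : ∀ k : ℕ, ∃ U₀ : Site d → Fin d → (Matrix n n ℂ)ˣ, U₀ ∈ admissible (sfClass d L N ε) L (k + 1) W ∧ SmallField U₀ 0)
    (hopen : ∀ (k : ℕ), ∀ τ₀ ∈ Icc (0 : ℝ) 1,
      (∃ U : Site d → Fin d → (Matrix n n ℂ)ˣ, U ∈ admissible (sfClass d L N ε) L (k + 1) (vary W (τ₀ • A) 1) ∧ SmallField U (δ / ((L : ℝ) ^ (k + 1)) ^ 2) ∧
        ∀ φ : Site d → Fin d → Matrix n n ℂ, IsSkewDir φ → IsPeriodicDir φ ((N * L ^ (k + 1) : ℕ) : ℤ) → TangentIter L k U φ →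
          dAction U φ (perWin d (N * L ^ (k + 1))) = 0) →
      ∃ ρ : ℝ, 0 < ρ ∧ ∀ τ ∈ Icc (0 : ℝ) 1, |τ - τ₀| < ρ →
        ∃ U : Site d → Fin d → (Matrix n n ℂ)ˣ, U ∈ admissible (sfClass d L N ε) L (k + 1) (vary W (τ • A) 1) ∧ SmallField U (δ / ((L : ℝ) ^ (k + 1)) ^ 2) ∧
          ∀ φ : Site d → Fin d → Matrix n n ℂ, IsSkewDir φ → IsPeriodicDir φ ((N * L ^ (k + 1) : ℕ) : ℤ) → TangentIter L k U φ →
            dAction U φ (perWin d (N * L ^ (k + 1))) = 0)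
    (hrepU : ∀ (k : ℕ) (Us : Site d → Fin d → (Matrix n n ℂ)ˣ), Us ∈ admissible (sfClass d L N ε) L (k + 1) (vary W A 1) →
      SmallField Us (δ / ((L : ℝ) ^ (k + 1)) ^ 2) →
      (∀ φ : Site d → Fin d → Matrix n n ℂ, IsSkewDir φ → IsPeriodicDir φ ((N * L ^ (k + 1) : ℕ) : ℤ) → TangentIter L k Us φ →
        dAction Us φ (perWin d (N * L ^ (k + 1))) = 0) →
      ∀ U' ∈ admissible (sfClass d L N ε) L (k + 1) (vary W A 1), ∃ (X XT XN : Site d → Fin d → Matrix n n ℂ) (α ν κ₁ : ℝ),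
        IsSkewDir X ∧ IsPeriodicDir X ((N * L ^ (k + 1) : ℕ) : ℤ) ∧ 0 ≤ α ∧ (∀ x μ, ‖X x μ‖ ≤ α) ∧
        levelAction d L N (k + 1) (vary Us X 1) ≤ levelAction d L N (k + 1) U' ∧
        SmallField (vary Us X 1) (ε / ((L : ℝ) ^ (k + 1)) ^ 2) ∧
        X = XT + XN ∧ XT ∈ frameFreeBlockLandauW (d := d) (n := n) L N (k + 1) Us ∧ IsSkewDir XN ∧ 0 ≤ ν ∧
        energyNormW L (k + 1) Us XN (periodBox (d := d) (N * L ^ (k + 1)))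
          ≤ ν * energyNormW L (k + 1) Us X (periodBox (d := d) (N * L ^ (k + 1))) ∧
        ε / ((L : ℝ) ^ (k + 1)) ^ 2 * (∑ p ∈ perWin d (N * L ^ (k + 1)), ‖curl Us XN p‖)
          ≤ κ₁ * energyNormW L (k + 1) Us X (periodBox (d := d) (N * L ^ (k + 1))) ^ 2 ∧
        2 * κ₁ ≤ ((((1 / 2 - ν ^ 2) / (2 * (1 + CP)) - ν ^ 2) / 2
            - 576 * d * (Real.exp α - 1) ^ 2 * ((L : ℝ) ^ (k + 1)) ^ 2) / (Fintype.card n : ℝ)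
            - 28 * d * (ε / ((L : ℝ) ^ (k + 1)) ^ 2 + 7 * α ^ 2) * ((L : ℝ) ^ (k + 1)) ^ 2)) :
    ∀ (k : ℕ) (U₀ : Site d → Fin d → (Matrix n n ℂ)ˣ), U₀ ∈ admissible (sfClass d L N ε) L (k + 1) (vary W A 1) →
      SmallField U₀ (δ / ((L : ℝ) ^ k) ^ 2) →
      ∃ U, IsMinimiser d (sfClass d L N ε) L N (k + 1) (vary W A 1) U ∧ SmallField U (δ / ((L : ℝ) ^ (k + 1)) ^ 2) := by
  have h0' : ∀ k : ℕ, ∃ U₀ : Site d → Fin d → (Matrix n n ℂ)ˣ,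
      U₀ ∈ admissible (sfClass d L N ε) L (k + 1) ((fun τ : ℝ => vary W (τ • A) 1) 0) ∧ SmallField U₀ 0 := by
    intro k; simpa only [expPath_zero] using h0 k
  have h1 : (fun τ : ℝ => vary W (τ • A) 1) 1 = vary W A 1 := expPath_one W A
  exact oneStep_of_path_open_repW hL hN hε0 hε1 hε2 hδ hCP hls hP (fun τ : ℝ => vary W (τ • A) 1) (continuous_expPath W A).continuousOn h0' h1
    hopen hrepU

end

end Summit.QuantumFields.BalabanUV.T4Continuum.NE7DataPathExp
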